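import HarnessLib
import Summits.CriticalPhenomena.PercolationContinuityZ3.Theorems.PercLowPointHalfSpaceQuantitativeBGNHalfSpaceBlocking

/-!
# Crux `PercLowPointHalfSpace.QuantitativeBGN` (stmt-CriticalPhenomena-0913) — half-space blocking at a general aspect ratio

Helper file landed `--supports stmt-CriticalPhenomena-0913` (lead c6), sequel to
`…QuantitativeBGNHalfSpaceBlocking.lean` (p140378). That file closed the crux C
(`∃ a > 0, C, ∀ r ≥ 1, P_{p_c(ℤ³)}(arm_H(0,r)) ≤ C r^{-a}`) from a scale-uniform bound on the
probability of the half-annulus crossing `HC_n = {Λ_n ∩ H ↔ ∂ⁱⁿΛ_{2n} inside Λ_{2n} ∩ H}` of ASPECT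
RATIO 2. Monte-Carlo calibration at `p_c` (kit j022425, attached to the item: `u^H_n = P(¬ HC_n) = 0/N`
for `n = 2, …, 64`, `N` up to 4000, while `P(arm_H(0,r))` decays like `r^{-0.99}`) shows that ratio 2
is the wrong knob: whole half-annuli of ratio 2 are essentially never blocked at lattice-accessible
scales. Blocking becomes an event of order-one probability only at larger aspect ratio `k` (a crossing
`Λ_n ↔ ∂Λ_{kn}` is a one-arm event from a ball, of probability `≍ k^{-x}`), and there is no
Russo–Seymour–Welsh theory in `d = 3` to trade one aspect ratio for another. This file therefore
proves the criterion at EVERY dyadic aspect ratio `2^s`, `s ≥ 1`, for every `p`. Write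
`HC^{(M)}_n = {∃ x ∈ Λ_n, ∃ y ∈ ∂ⁱⁿΛ_M, x ↔ y open inside Λ_M ∩ H}` (`n < M`).

* `HalfSpaceBlockingPow.real_halfCross_anti_outer` — `P_p(HC^{(M')}_n) ≤ P_p(HC^{(M)}_n)` for
  `n < M ≤ M'` (first exit from `Λ_{M-1}`): the hypothesis below gets WEAKER as `s` grows.
* `HalfSpaceBlockingPow.real_armH_le_prod_pow` — multi-scale product over the scales `2^{sj}`:
  `P_p(arm_H(0, 2^{sQ} + 1)) ≤ Π_{j<Q} P_p(HC^{(2^s·2^{sj})}_{2^{sj}})` (independent pure events on the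
  disjoint edge classes `Λ_{2^{s(j+1)}}.sym2 ∖ Λ_{2^{sj}}.sym2`; no decoupling hypothesis).
* `HalfSpaceBlockingPow.real_armH_le_exp_of_crossingBoundPow` — if `P_p(HC^{(2^s n)}_n) ≤ 1 - η` for
  `n ≥ n₀` then `P_p(arm_H(0, 2^K + 1)) ≤ exp(-(η/(2s)) K)` for `K ≥ s (2 n₀ + 2)`.
* `HalfSpaceBlockingPow.quantitativeBGNAt_of_crossingBoundPow` — hence `QuantitativeBGNAt p` with
  exponent `a = η/(2s)` (dyadic interpolation `HalfSpaceBlocking.real_armH_le_of_two_pow`).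
* `quantitativeBGN_of_halfAnnulusCrossingBoundPow` (registered sub-goal) — at `p = p_c(ℤ³)`:
  `(∃ s ≥ 1, η > 0, n₀, ∀ n ≥ n₀, P_{p_c}(HC^{(2^s n)}_n) ≤ 1 - η) → QuantitativeBGN`.
* `quantitativeBGN_of_halfAnnulusCrossingBoundRatio` (registered sub-goal) — the same at any integer
  aspect ratio `k ≥ 2` (`HC^{(kn)}_n`; exponent `a = η/(2k)`, via `2^k ≥ k` and `real_halfCross_anti_outer`).
* `quantitativeBGN_of_annulusCrossingBoundRatio` (registered sub-goal) — the BULK form: the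
  "eventually, ratio `k`" weakening of `X_B = CritAnnulusNonCrossing` (stmt-0846: `k = 2`, all `n ≥ 1`)
  closes the crux (`real_halfCross_le_real_annulusCross`: an `H`-crossing is a crossing).

No definitions, no sorry. Sources: Grimmett, *Percolation* (1999), §1.4, Thm. (7.35)
[GrimmettPercolation1999]; Bollobás–Riordan, *Percolation* (2006), Ch. 3, proof of Thm. 6
(independent annuli) [BollobasRiordan2006].
-/

noncomputable section

namespace Summit.CriticalPhenomena.PercolationContinuityZ3.Theorems

namespace HalfSpaceBlockingPow

open MeasureTheory Filter
open Literature.Probability.Percolation Literature.Probability.LatticeModels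
open Literature.Probability.Percolation.DCT16
open Summit.CriticalPhenomena.PercolationContinuityZ3.Theorems.QuantitativeBGN.Negative
  (armH QuantitativeBGNAt quantitativeBGN_iff armH_antitone)
open Summit.CriticalPhenomena.PercolationContinuityZ3.FreeBoxPowerSavingLine.CesaroBlockingGivesOneArm
  (determinedBy_setOf_inter_mem real_biInter_range_eq_prod mem_innerBoundary_box_of_notMem)

/-! ### The half-space crossing event `HC^{(M)}_n` at a general outer radius -/

/-- `HC^{(M)}_n` is an increasing event. [folklore] -/
theorem isUpperSet_halfCross (n M : ℕ) :
    IsUpperSet {ω : BondConfig (Site 3) | ∃ x ∈ box 3 n,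
      ∃ y ∈ innerBoundary (zdGraph 3) (box 3 M),
        ω ∈ openConnIn ((↑(box 3 M) : Set (Site 3)) ∩ {x : Site 3 | 0 ≤ x 0}) x y} := by
  rintro ω ω' hle ⟨x, hx, y, hy, hω⟩
  exact ⟨x, hx, y, hy, isUpperSet_openConnIn _ x y hle hω⟩

/-- Restricting a configuration to the edge class `Λ_M.sym2 ∖ Λ_n.sym2` keeps every open edge
with both endpoints in `Λ_M` and one endpoint outside `Λ_n`. [folklore] -/
theorem openGraph_inter_adj {ω : BondConfig (Site 3)} {n M : ℕ} {u v : Site 3}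
    (hu : u ∈ box 3 M) (hv : v ∈ box 3 M) (huv : u ∉ box 3 n ∨ v ∉ box 3 n)
    (h : (openGraph ω).Adj u v) :
    (openGraph (ω ∩ ↑((box 3 M).sym2 \ (box 3 n).sym2))).Adj u v := by
  rw [openGraph_adj] at h ⊢
  refine ⟨⟨h.1, ?_⟩, h.2⟩
  rw [Finset.mem_coe, Finset.mem_sdiff, Finset.mk_mem_sym2_iff, Finset.mk_mem_sym2_iff]
  exact ⟨⟨hu, hv⟩, fun h' => huv.elim (fun h => h h'.1) fun h => h h'.2⟩

/-- **The pure crossing `Λ_n → ∂ⁱⁿΛ_M` of an `H`-arm** (`n < M ≤ N`). In a lattice configuration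
`ω ⊆ E(ℤ³)`, an open path inside `H` from `0` to a point outside `Λ_N` gives
`ω ∩ (Λ_M.sym2 ∖ Λ_n.sym2) ∈ HC^{(M)}_n`: read the path from its LAST visit to `Λ_n` to its FIRST
subsequent visit to `∂ⁱⁿΛ_M`. (The case `M = 2n` is `HalfSpaceBlocking.mem_halfCross_inter_of_pathIn`.)
[folklore] -/
theorem mem_halfCross_inter_of_pathIn {n M N : ℕ} (hnM : n < M) (hMN : M ≤ N)
    {ω : BondConfig (Site 3)} (hω : ω ⊆ (zdGraph 3).edgeSet) {y : Site 3}
    (hy : y ∉ box 3 N) (h : PathIn (openGraph ω) {x : Site 3 | 0 ≤ x 0} 0 y) :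
    ω ∩ ↑((box 3 M).sym2 \ (box 3 n).sym2) ∈
      {ω : BondConfig (Site 3) | ∃ x ∈ box 3 n,
        ∃ y ∈ innerBoundary (zdGraph 3) (box 3 M),
          ω ∈ openConnIn ((↑(box 3 M) : Set (Site 3)) ∩ {x : Site 3 | 0 ≤ x 0}) x y} := by
  obtain ⟨m, hm⟩ : ∃ m : ℕ, m + 1 = M := ⟨M - 1, by omega⟩
  have hyn : y ∉ (↑(box 3 n) : Set (Site 3)) := fun h' =>
    hy (box_mono 3 (by omega) (Finset.mem_coe.1 h'))
  have hym : y ∉ (↑(box 3 m) : Set (Site 3)) := fun h' =>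
    hy (box_mono 3 (by omega) (Finset.mem_coe.1 h'))
  -- last visit to `Λ_n`
  obtain ⟨a, b, ha, haH, hb, hab, hpath⟩ :=
    h.last_exit (C := (↑(box 3 n) : Set (Site 3))) (Finset.mem_coe.2 (zero_mem_box 3 n)) hyn
  have ha' : a ∈ box 3 n := Finset.mem_coe.1 ha
  have haM : a ∈ box 3 M := box_mono 3 (by omega) ha'
  have hbM : b ∈ box 3 M :=
    box_mono 3 (by omega) (DCT16.mem_box_succ_of_adj ha' (adj_of_openGraph_adj hω hab))
  have hbH : b ∈ {x : Site 3 | 0 ≤ x 0} := hpath.left_mem.1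
  have hbn : b ∉ box 3 n := fun h' => hb (Finset.mem_coe.2 h')
  have hfirst : PathIn (openGraph (ω ∩ ↑((box 3 M).sym2 \ (box 3 n).sym2)))
      ((↑(box 3 M) : Set (Site 3)) ∩ {x : Site 3 | 0 ≤ x 0}) a b :=
    PathIn.of_adj ⟨Finset.mem_coe.2 haM, haH⟩ ⟨Finset.mem_coe.2 hbM, hbH⟩
      (openGraph_inter_adj haM hbM (Or.inr hbn) hab)
  by_cases hbm : b ∈ (↑(box 3 m) : Set (Site 3))
  · -- first visit to `∂ⁱⁿΛ_M` after `b`: first exit from `Λ_m`, `m + 1 = M`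
    obtain ⟨a', b', ha'm, hb'm, hb'A, hab', hmid⟩ := hpath.exit hbm hym
    have ha'm' : a' ∈ box 3 m := Finset.mem_coe.1 ha'm
    have ha'M : a' ∈ box 3 M := box_mono 3 (by omega) ha'm'
    have hb'M : b' ∈ box 3 M :=
      hm ▸ DCT16.mem_box_succ_of_adj ha'm' (adj_of_openGraph_adj hω hab')
    have hb'm' : b' ∉ box 3 m := fun h' => hb'm (Finset.mem_coe.2 h')
    have hmid' : PathIn (openGraph (ω ∩ ↑((box 3 M).sym2 \ (box 3 n).sym2)))
        ((↑(box 3 M) : Set (Site 3)) ∩ {x : Site 3 | 0 ≤ x 0}) b a' := by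
      refine (pathIn_congrGraph (fun u v hu hv huv => openGraph_inter_adj
        (box_mono 3 (by omega) (Finset.mem_coe.1 hu.1))
        (box_mono 3 (by omega) (Finset.mem_coe.1 hv.1))
        (Or.inl fun h' => hu.2.2 (Finset.mem_coe.2 h')) huv) hmid).mono fun z hz => ?_
      exact ⟨Finset.mem_coe.2 (box_mono 3 (by omega) (Finset.mem_coe.1 hz.1)), hz.2.1⟩
    have ha'n : a' ∉ box 3 n := fun h' => hmid.right_mem.2.2 (Finset.mem_coe.2 h')
    exact ⟨a, ha', b', mem_innerBoundary_box_of_notMem hm hb'M hb'm',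
      mem_openConnIn_of_pathIn ((hfirst.trans hmid').tail
        (openGraph_inter_adj ha'M hb'M (Or.inl ha'n) hab') ⟨Finset.mem_coe.2 hb'M, hb'A.1⟩)⟩
  · have hbm' : b ∉ box 3 m := fun h' => hbm (Finset.mem_coe.2 h')
    exact ⟨a, ha', b, mem_innerBoundary_box_of_notMem hm hbM hbm', mem_openConnIn_of_pathIn hfirst⟩

/-- **Larger aspect ratio, smaller crossing probability**: for `n < M ≤ M'`,
`P_p(HC^{(M')}_n) ≤ P_p(HC^{(M)}_n)` — an open path inside `Λ_{M'} ∩ H` from `Λ_n` to `∂ⁱⁿΛ_{M'}`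
meets `∂ⁱⁿΛ_M` at its first exit from `Λ_{M-1}`, before leaving `Λ_M`. [folklore] -/
theorem real_halfCross_anti_outer (p : unitInterval) {n M M' : ℕ} (hnM : n < M) (hMM' : M ≤ M') :
    (bondPercolation (zdGraph 3) p).real
        {ω : BondConfig (Site 3) | ∃ x ∈ box 3 n,
          ∃ y ∈ innerBoundary (zdGraph 3) (box 3 M'),
            ω ∈ openConnIn ((↑(box 3 M') : Set (Site 3)) ∩ {x : Site 3 | 0 ≤ x 0}) x y} ≤
      (bondPercolation (zdGraph 3) p).real
        {ω : BondConfig (Site 3) | ∃ x ∈ box 3 n,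
          ∃ y ∈ innerBoundary (zdGraph 3) (box 3 M),
            ω ∈ openConnIn ((↑(box 3 M) : Set (Site 3)) ∩ {x : Site 3 | 0 ≤ x 0}) x y} := by
  refine real_mono_of_forall_subset_edgeSet (zdGraph 3) p fun ω hω h => ?_
  obtain ⟨x, hx, y, hy, hconn⟩ := h
  obtain ⟨m, hm⟩ : ∃ m : ℕ, m + 1 = M := ⟨M - 1, by omega⟩
  have hpath : PathIn (openGraph ω) ((↑(box 3 M') : Set (Site 3)) ∩ {x : Site 3 | 0 ≤ x 0}) x y :=
    DCT16.mem_openConnIn_iff_pathIn.1 hconn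
  -- `y ∈ ∂ⁱⁿΛ_{M'}` is outside `Λ_m` (`m + 1 = M ≤ M'`)
  have hym : y ∉ (↑(box 3 m) : Set (Site 3)) := by
    intro h'
    obtain ⟨-, z, hz, hyz⟩ := mem_innerBoundary_iff.1 hy
    exact hz (box_mono 3 (by omega) (DCT16.mem_box_succ_of_adj (Finset.mem_coe.1 h') hyz))
  have hxm : x ∈ (↑(box 3 m) : Set (Site 3)) := Finset.mem_coe.2 (box_mono 3 (by omega) hx)
  obtain ⟨a, b, ham, hbm, hbA, hab, hinit⟩ := hpath.exit hxm hym
  have ham' : a ∈ box 3 m := Finset.mem_coe.1 ham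
  have hbM : b ∈ box 3 M := hm ▸ DCT16.mem_box_succ_of_adj ham' (adj_of_openGraph_adj hω hab)
  have hbm' : b ∉ box 3 m := fun h' => hbm (Finset.mem_coe.2 h')
  have hinit' : PathIn (openGraph ω) ((↑(box 3 M) : Set (Site 3)) ∩ {x : Site 3 | 0 ≤ x 0}) x a :=
    hinit.mono fun z hz => ⟨Finset.mem_coe.2 (box_mono 3 (by omega) (Finset.mem_coe.1 hz.1)), hz.2.2⟩
  exact ⟨x, hx, b, mem_innerBoundary_box_of_notMem hm hbM hbm',
    mem_openConnIn_of_pathIn (hinit'.tail hab ⟨Finset.mem_coe.2 hbM, hbA.2⟩)⟩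

/-! ### The multi-scale product bound over the scales `2^{sj}` -/

/-- `2^s · 2^{sj} = 2^{s(j+1)}`. -/
theorem two_pow_mul_two_pow_mul (s j : ℕ) : 2 ^ s * 2 ^ (s * j) = 2 ^ (s * (j + 1)) := by
  rw [mul_add, mul_one, pow_add, mul_comm]

/-- **Multi-scale product bound at aspect ratio `2^s`** (every `p`, `s`, `Q`):
`P_p(arm_H(0, 2^{sQ} + 1)) ≤ Π_{j<Q} P_p(HC^{(2^s · 2^{sj})}_{2^{sj}})`. [folklore] -/
theorem real_armH_le_prod_pow (p : unitInterval) {s : ℕ} (hs : 1 ≤ s) (Q : ℕ) :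
    (bondPercolation (zdGraph 3) p).real (armH (2 ^ (s * Q) + 1)) ≤
      ∏ j ∈ Finset.range Q, (bondPercolation (zdGraph 3) p).real
        {ω : BondConfig (Site 3) | ∃ x ∈ box 3 (2 ^ (s * j)),
          ∃ y ∈ innerBoundary (zdGraph 3) (box 3 (2 ^ s * 2 ^ (s * j))),
            ω ∈ openConnIn ((↑(box 3 (2 ^ s * 2 ^ (s * j))) : Set (Site 3)) ∩
              {x : Site 3 | 0 ≤ x 0}) x y} := by
  have hF : Monotone fun j : ℕ => (box 3 (2 ^ (s * j))).sym2 := fun i j hij =>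
    Finset.sym2_mono (box_mono 3 (Nat.pow_le_pow_right two_pos (Nat.mul_le_mul_left s hij)))
  have hlt : ∀ j : ℕ, 2 ^ (s * j) < 2 ^ s * 2 ^ (s * j) := fun j => by
    rw [two_pow_mul_two_pow_mul]
    refine Nat.pow_lt_pow_right (by norm_num) ?_
    rw [mul_add, mul_one]
    omega
  -- the pure events
  set A : ℕ → Set (BondConfig (Site 3)) := fun j =>
    {ω | ω ∩ ↑((box 3 (2 ^ (s * (j + 1)))).sym2 \ (box 3 (2 ^ (s * j))).sym2) ∈
      {ω : BondConfig (Site 3) | ∃ x ∈ box 3 (2 ^ (s * j)),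
        ∃ y ∈ innerBoundary (zdGraph 3) (box 3 (2 ^ s * 2 ^ (s * j))),
          ω ∈ openConnIn ((↑(box 3 (2 ^ s * 2 ^ (s * j))) : Set (Site 3)) ∩
            {x : Site 3 | 0 ≤ x 0}) x y}} with hA
  calc (bondPercolation (zdGraph 3) p).real (armH (2 ^ (s * Q) + 1))
      ≤ (bondPercolation (zdGraph 3) p).real (⋂ j ∈ Finset.range Q, A j) := by
        refine real_mono_of_forall_subset_edgeSet (zdGraph 3) p fun ω hω h => ?_
        obtain ⟨y, ⟨i, hi⟩, hconn⟩ := h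
        have hpath : PathIn (openGraph ω) {x : Site 3 | 0 ≤ x 0} 0 y :=
          DCT16.mem_openConnIn_iff_pathIn.1 hconn
        have hy : y ∉ box 3 (2 ^ (s * Q)) := by
          rw [mem_box, not_forall]
          refine ⟨i, fun hb => ?_⟩
          have := abs_le.mpr hb
          push_cast at hi this
          omega
        refine Set.mem_iInter₂.2 fun j hj => ?_
        have hjQ : 2 ^ (s * (j + 1)) ≤ 2 ^ (s * Q) :=
          Nat.pow_le_pow_right two_pos (Nat.mul_le_mul_left s (Finset.mem_range.1 hj))
        simp only [hA, Set.mem_setOf_eq]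
        rw [← two_pow_mul_two_pow_mul] at hjQ ⊢
        exact mem_halfCross_inter_of_pathIn (hlt j) hjQ hω hy hpath
    _ = ∏ j ∈ Finset.range Q, (bondPercolation (zdGraph 3) p).real (A j) :=
        real_biInter_range_eq_prod (zdGraph 3) p hF (A := A)
          (fun j => by simp only [hA]; exact determinedBy_setOf_inter_mem _ _) Q
    _ ≤ ∏ j ∈ Finset.range Q, (bondPercolation (zdGraph 3) p).real
          {ω : BondConfig (Site 3) | ∃ x ∈ box 3 (2 ^ (s * j)),
            ∃ y ∈ innerBoundary (zdGraph 3) (box 3 (2 ^ s * 2 ^ (s * j))),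
              ω ∈ openConnIn ((↑(box 3 (2 ^ s * 2 ^ (s * j))) : Set (Site 3)) ∩
                {x : Site 3 | 0 ≤ x 0}) x y} :=
        Finset.prod_le_prod (fun _ _ => measureReal_nonneg) fun j _ =>
          measureReal_mono fun ω hω => by
            simp only [hA, Set.mem_setOf_eq] at hω
            exact isUpperSet_halfCross (2 ^ (s * j)) _ Set.inter_subset_left hω

/-! ### From the crossing bound at ratio `2^s` to the dyadic exponential bound -/

/-- Under `P_p(HC^{(2^s n)}_n) ≤ 1 - η` for `n ≥ n₀`: `P_p(arm_H(0, 2^{sQ} + 1)) ≤ exp(-η (Q - n₀))`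
for `Q ≥ n₀` (the factors `j < n₀` are bounded by `1`, the others by `1 - η ≤ e^{-η}`, as
`2^{sj} ≥ j`). [folklore] -/
theorem real_armH_le_exp_sub (p : unitInterval) {s : ℕ} (hs : 1 ≤ s) {η : ℝ} {n₀ : ℕ}
    (h : ∀ n : ℕ, n₀ ≤ n → (bondPercolation (zdGraph 3) p).real
      {ω : BondConfig (Site 3) | ∃ x ∈ box 3 n,
        ∃ y ∈ innerBoundary (zdGraph 3) (box 3 (2 ^ s * n)),
          ω ∈ openConnIn ((↑(box 3 (2 ^ s * n)) : Set (Site 3)) ∩ {x : Site 3 | 0 ≤ x 0}) x y}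
            ≤ 1 - η)
    {Q : ℕ} (hQ : n₀ ≤ Q) :
    (bondPercolation (zdGraph 3) p).real (armH (2 ^ (s * Q) + 1)) ≤
      Real.exp (-(η * ((Q : ℝ) - n₀))) := by
  set f : ℕ → ℝ := fun j => (bondPercolation (zdGraph 3) p).real
      {ω : BondConfig (Site 3) | ∃ x ∈ box 3 (2 ^ (s * j)),
        ∃ y ∈ innerBoundary (zdGraph 3) (box 3 (2 ^ s * 2 ^ (s * j))),
          ω ∈ openConnIn ((↑(box 3 (2 ^ s * 2 ^ (s * j))) : Set (Site 3)) ∩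
            {x : Site 3 | 0 ≤ x 0}) x y} with hf
  have hf0 : ∀ j, 0 ≤ f j := fun j => measureReal_nonneg
  have hf1 : ∀ j, f j ≤ 1 := fun j => measureReal_le_one
  have hfexp : ∀ j ∈ Finset.Ico n₀ Q, f j ≤ Real.exp (-η) := by
    intro j hj
    have hj : n₀ ≤ 2 ^ (s * j) := ((Finset.mem_Ico.1 hj).1.trans (Nat.lt_two_pow_self).le).trans
      (Nat.pow_le_pow_right two_pos (Nat.le_mul_of_pos_left j (by omega)))
    have := h (2 ^ (s * j)) hj
    have h1 := Real.one_sub_le_exp_neg η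
    simp only [hf]
    linarith
  calc (bondPercolation (zdGraph 3) p).real (armH (2 ^ (s * Q) + 1))
      ≤ ∏ j ∈ Finset.range Q, f j := real_armH_le_prod_pow p hs Q
    _ = (∏ j ∈ Finset.range n₀, f j) * ∏ j ∈ Finset.Ico n₀ Q, f j :=
        (Finset.prod_range_mul_prod_Ico f hQ).symm
    _ ≤ 1 * ∏ j ∈ Finset.Ico n₀ Q, Real.exp (-η) := by
        refine mul_le_mul (Finset.prod_le_one (fun j _ => hf0 j) fun j _ => hf1 j)
          (Finset.prod_le_prod (fun j _ => hf0 j) hfexp)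
          (Finset.prod_nonneg fun j _ => hf0 j) zero_le_one
    _ = Real.exp (-(η * ((Q : ℝ) - n₀))) := by
        rw [one_mul, Finset.prod_const, Nat.card_Ico, ← Real.exp_nat_mul, Nat.cast_sub hQ]
        ring_nf

/-- **Dyadic exponential bound from the crossing bound at ratio `2^s`**: if
`P_p(HC^{(2^s n)}_n) ≤ 1 - η` for all `n ≥ n₀` (`η > 0`, `s ≥ 1`), then
`P_p(arm_H(0, 2^K + 1)) ≤ exp(-(η/(2s)) K)` for every `K ≥ s (2 n₀ + 2)` (take `Q = ⌊K/s⌋`,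
`arm_H` antitone). [folklore] -/
theorem real_armH_le_exp_of_crossingBoundPow (p : unitInterval) {s : ℕ} (hs : 1 ≤ s) {η : ℝ}
    (hη : 0 < η) {n₀ : ℕ}
    (h : ∀ n : ℕ, n₀ ≤ n → (bondPercolation (zdGraph 3) p).real
      {ω : BondConfig (Site 3) | ∃ x ∈ box 3 n,
        ∃ y ∈ innerBoundary (zdGraph 3) (box 3 (2 ^ s * n)),
          ω ∈ openConnIn ((↑(box 3 (2 ^ s * n)) : Set (Site 3)) ∩ {x : Site 3 | 0 ≤ x 0}) x y}
            ≤ 1 - η)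
    {K : ℕ} (hK : s * (2 * n₀ + 2) ≤ K) :
    (bondPercolation (zdGraph 3) p).real (armH (2 ^ K + 1)) ≤
      Real.exp (-(η / (2 * s) * K)) := by
  have hs0 : 0 < s := by omega
  set Q := K / s with hQdef
  have hQ : 2 * n₀ + 2 ≤ Q := (Nat.le_div_iff_mul_le hs0).2 (by rw [mul_comm]; exact hK)
  have hQn₀ : n₀ ≤ Q := by omega
  have hsQK : s * Q ≤ K := by rw [mul_comm]; exact Nat.div_mul_le_self K s
  have hKsQ : K < s * Q + s := by
    have h1 := Nat.div_add_mod K s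
    rw [← hQdef] at h1
    have h2 := Nat.mod_lt K hs0
    omega
  have hmono : (bondPercolation (zdGraph 3) p).real (armH (2 ^ K + 1)) ≤
      (bondPercolation (zdGraph 3) p).real (armH (2 ^ (s * Q) + 1)) :=
    measureReal_mono (armH_antitone
      (Nat.succ_le_succ (Nat.pow_le_pow_right two_pos hsQK)))
  refine hmono.trans ((real_armH_le_exp_sub p hs h hQn₀).trans (Real.exp_le_exp.2 ?_))
  -- `(η/(2s)) K ≤ η (Q - n₀)`
  have hsR : (0 : ℝ) < s := by exact_mod_cast hs0
  have hKR : (K : ℝ) < s * Q + s := by exact_mod_cast hKsQ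
  have hQR : (2 * n₀ + 2 : ℝ) ≤ Q := by exact_mod_cast hQ
  rw [neg_le_neg_iff, div_mul_eq_mul_div, div_le_iff₀ (by positivity)]
  nlinarith [mul_le_mul_of_nonneg_left hQR (mul_pos hη hsR).le,
    mul_le_mul_of_nonneg_left hKR.le hη.le]

/-- **The half-annulus crossing bound at aspect ratio `2^s` gives the crux's bound at `p`**
(every `p`): exponent `a = η/(2s)`, constant from `HalfSpaceBlocking.real_armH_le_of_two_pow`.
[folklore] -/
theorem quantitativeBGNAt_of_crossingBoundPow (p : unitInterval) {s : ℕ} (hs : 1 ≤ s) {η : ℝ}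
    (hη : 0 < η) {n₀ : ℕ}
    (h : ∀ n : ℕ, n₀ ≤ n → (bondPercolation (zdGraph 3) p).real
      {ω : BondConfig (Site 3) | ∃ x ∈ box 3 n,
        ∃ y ∈ innerBoundary (zdGraph 3) (box 3 (2 ^ s * n)),
          ω ∈ openConnIn ((↑(box 3 (2 ^ s * n)) : Set (Site 3)) ∩ {x : Site 3 | 0 ≤ x 0}) x y}
            ≤ 1 - η) :
    QuantitativeBGNAt p := by
  have hc : 0 < η / (2 * s) := by
    have : (0 : ℝ) < s := by exact_mod_cast (show 0 < s by omega)
    positivity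
  refine ⟨η / (2 * s), (2 : ℝ) ^ (η / (2 * s)) + ((2 : ℝ) ^ (s * (2 * n₀ + 2) + 1)) ^ (η / (2 * s)),
    hc, fun r hr => ?_⟩
  exact HalfSpaceBlocking.real_armH_le_of_two_pow p hc.le
    (fun K hK => real_armH_le_exp_of_crossingBoundPow p hs hη h hK) hr

/-- **Any integer aspect ratio `k ≥ 2`** (every `p`): if `P_p(HC^{(kn)}_n) ≤ 1 - η` for all
`n ≥ n₀` then `QuantitativeBGNAt p` — by `real_halfCross_anti_outer` the bound passes to the dyadic
ratio `2^k ≥ k` (for `n ≥ 1`), and `quantitativeBGNAt_of_crossingBoundPow` applies with `s = k`.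
[folklore] -/
theorem quantitativeBGNAt_of_crossingBoundRatio (p : unitInterval) {k : ℕ} (hk : 2 ≤ k) {η : ℝ}
    (hη : 0 < η) {n₀ : ℕ}
    (h : ∀ n : ℕ, n₀ ≤ n → (bondPercolation (zdGraph 3) p).real
      {ω : BondConfig (Site 3) | ∃ x ∈ box 3 n,
        ∃ y ∈ innerBoundary (zdGraph 3) (box 3 (k * n)),
          ω ∈ openConnIn ((↑(box 3 (k * n)) : Set (Site 3)) ∩ {x : Site 3 | 0 ≤ x 0}) x y}
            ≤ 1 - η) :
    QuantitativeBGNAt p := by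
  refine quantitativeBGNAt_of_crossingBoundPow p (s := k) (by omega) hη (n₀ := max n₀ 1)
    fun n hn => ?_
  have hn1 : 1 ≤ n := le_of_max_le_right hn
  have hkn : n < k * n := by nlinarith
  have hle : k * n ≤ 2 ^ k * n := Nat.mul_le_mul_right n (Nat.lt_two_pow_self).le
  exact (real_halfCross_anti_outer p hkn hle).trans (h n (le_of_max_le_left hn))

/-- **Half-space crossing implies bulk crossing** at any outer radius: `P_p(HC^{(M)}_n) ≤ P_p(C^{(M)}_n)`
with `C^{(M)}_n = {∃ x ∈ Λ_n, ∃ y ∈ ∂ⁱⁿΛ_M, x ↔ y open inside Λ_M}` (an `H`-crossing is a crossing); dually,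
bulk blocking is the stronger hypothesis. [folklore] -/
theorem real_halfCross_le_real_annulusCross (p : unitInterval) (n M : ℕ) :
    (bondPercolation (zdGraph 3) p).real
        {ω : BondConfig (Site 3) | ∃ x ∈ box 3 n,
          ∃ y ∈ innerBoundary (zdGraph 3) (box 3 M),
            ω ∈ openConnIn ((↑(box 3 M) : Set (Site 3)) ∩ {x : Site 3 | 0 ≤ x 0}) x y} ≤
      (bondPercolation (zdGraph 3) p).real
        {ω : BondConfig (Site 3) | ∃ x ∈ box 3 n,
          ∃ y ∈ innerBoundary (zdGraph 3) (box 3 M), ω ∈ openConnIn (↑(box 3 M) : Set (Site 3)) x y} :=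
  measureReal_mono fun _ ⟨x, hx, y, hy, h⟩ =>
    ⟨x, hx, y, hy, openConnIn_mono Set.inter_subset_left x y h⟩

/-- **Bulk version, any integer aspect ratio `k ≥ 2`** (every `p`): if the BULK annulus of ratio `k`
is crossed with probability `≤ 1 - η` for all `n ≥ n₀` — the "eventually, ratio `k`" form of
`X_B = PercAnnulusCrossing.CritAnnulusNonCrossing` — then `QuantitativeBGNAt p`. [folklore] -/
theorem quantitativeBGNAt_of_bulkCrossingBoundRatio (p : unitInterval) {k : ℕ} (hk : 2 ≤ k) {η : ℝ}
    (hη : 0 < η) {n₀ : ℕ}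
    (h : ∀ n : ℕ, n₀ ≤ n → (bondPercolation (zdGraph 3) p).real
      {ω : BondConfig (Site 3) | ∃ x ∈ box 3 n,
        ∃ y ∈ innerBoundary (zdGraph 3) (box 3 (k * n)),
          ω ∈ openConnIn (↑(box 3 (k * n)) : Set (Site 3)) x y} ≤ 1 - η) :
    QuantitativeBGNAt p :=
  quantitativeBGNAt_of_crossingBoundRatio p hk hη fun n hn =>
    (real_halfCross_le_real_annulusCross p n (k * n)).trans (h n hn)

end HalfSpaceBlockingPow

open Literature.Probability.Percolation Literature.Probability.LatticeModels
open Summit.CriticalPhenomena.PercolationContinuityZ3.Theorems.QuantitativeBGN.Negative (quantitativeBGN_iff)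

/-- **Registered sub-goal: a scale-uniform half-annulus crossing bound at SOME dyadic aspect ratio
`2^s` at `p_c(ℤ³)` gives `QuantitativeBGN`.** With
`HC^{(2^s n)}_n = {∃ x ∈ Λ_n, ∃ y ∈ ∂ⁱⁿΛ_{2^s n}, x ↔ y open inside Λ_{2^s n} ∩ H}`: if for some `s ≥ 1`,
`η > 0`, `n₀`, `P_{p_c}(HC^{(2^s n)}_n) ≤ 1 - η` for all `n ≥ n₀`, then the crux holds (exponent
`a = η/(2s)`). The case `s = 1` is `quantitativeBGN_of_halfAnnulusCrossingBound`; by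
`HalfSpaceBlockingPow.real_halfCross_anti_outer` the hypothesis weakens as `s` grows. [folklore] -/
theorem quantitativeBGN_of_halfAnnulusCrossingBoundPow : (∃ s : ℕ, 1 ≤ s ∧ ∃ η : ℝ, 0 < η ∧ ∃ n₀ : ℕ, ∀ n : ℕ, n₀ ≤ n → (Literature.Probability.Percolation.bondPercolation (Literature.Probability.LatticeModels.zdGraph 3) (Literature.Probability.Percolation.criticalProbI 3)).real {ω | ∃ x ∈ Literature.Probability.LatticeModels.box 3 n, ∃ y ∈ Literature.Probability.LatticeModels.innerBoundary (Literature.Probability.LatticeModels.zdGraph 3) (Literature.Probability.LatticeModels.box 3 (2 ^ s * n)), ω ∈ Literature.Probability.Percolation.openConnIn ((↑(Literature.Probability.LatticeModels.box 3 (2 ^ s * n)) : Set (Literature.Probability.LatticeModels.Site 3)) ∩ {x : Literature.Probability.LatticeModels.Site 3 | 0 ≤ x 0}) x y} ≤ 1 - η) → Summit.CriticalPhenomena.PercolationContinuityZ3.Theses.PercLowPointHalfSpace.QuantitativeBGN :=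
  fun ⟨_, hs, _, hη, _, h⟩ => quantitativeBGN_iff.2
    (HalfSpaceBlockingPow.quantitativeBGNAt_of_crossingBoundPow _ hs hη h)

/-- **Registered sub-goal: a scale-uniform half-annulus crossing bound at SOME integer aspect
ratio `k ≥ 2` at `p_c(ℤ³)` gives `QuantitativeBGN`.** With
`HC^{(kn)}_n = {∃ x ∈ Λ_n, ∃ y ∈ ∂ⁱⁿΛ_{kn}, x ↔ y open inside Λ_{kn} ∩ H}`: if for some `k ≥ 2`, `η > 0`,
`n₀`, `P_{p_c}(HC^{(kn)}_n) ≤ 1 - η` for all `n ≥ n₀`, then the crux holds (exponent `a = η/(2k)`;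
`HalfSpaceBlockingPow.quantitativeBGNAt_of_crossingBoundRatio` at `p = p_c`). [folklore] -/
theorem quantitativeBGN_of_halfAnnulusCrossingBoundRatio : (∃ k : ℕ, 2 ≤ k ∧ ∃ η : ℝ, 0 < η ∧ ∃ n₀ : ℕ, ∀ n : ℕ, n₀ ≤ n → (Literature.Probability.Percolation.bondPercolation (Literature.Probability.LatticeModels.zdGraph 3) (Literature.Probability.Percolation.criticalProbI 3)).real {ω | ∃ x ∈ Literature.Probability.LatticeModels.box 3 n, ∃ y ∈ Literature.Probability.LatticeModels.innerBoundary (Literature.Probability.LatticeModels.zdGraph 3) (Literature.Probability.LatticeModels.box 3 (k * n)), ω ∈ Literature.Probability.Percolation.openConnIn ((↑(Literature.Probability.LatticeModels.box 3 (k * n)) : Set (Literature.Probability.LatticeModels.Site 3)) ∩ {x : Literature.Probability.LatticeModels.Site 3 | 0 ≤ x 0}) x y} ≤ 1 - η) → Summit.CriticalPhenomena.PercolationContinuityZ3.Theses.PercLowPointHalfSpace.QuantitativeBGN :=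
  fun ⟨_, hk, _, hη, _, h⟩ => quantitativeBGN_iff.2
    (HalfSpaceBlockingPow.quantitativeBGNAt_of_crossingBoundRatio _ hk hη h)

/-- **Registered sub-goal: the bulk annulus of SOME integer aspect ratio `k ≥ 2` is blocked at
`p_c(ℤ³)` with probability `≥ η` for all large `n` ⟹ `QuantitativeBGN`** — the "eventually, ratio `k`"
weakening of `X_B = PercAnnulusCrossing.CritAnnulusNonCrossing` (which is `k = 2`, all `n ≥ 1`) already
closes the crux (exponent `a = η/(2k)`; `HalfSpaceBlockingPow.quantitativeBGNAt_of_bulkCrossingBoundRatio`).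
[folklore] -/
theorem quantitativeBGN_of_annulusCrossingBoundRatio : (∃ k : ℕ, 2 ≤ k ∧ ∃ η : ℝ, 0 < η ∧ ∃ n₀ : ℕ, ∀ n : ℕ, n₀ ≤ n → (Literature.Probability.Percolation.bondPercolation (Literature.Probability.LatticeModels.zdGraph 3) (Literature.Probability.Percolation.criticalProbI 3)).real {ω | ∃ x ∈ Literature.Probability.LatticeModels.box 3 n, ∃ y ∈ Literature.Probability.LatticeModels.innerBoundary (Literature.Probability.LatticeModels.zdGraph 3) (Literature.Probability.LatticeModels.box 3 (k * n)), ω ∈ Literature.Probability.Percolation.openConnIn (↑(Literature.Probability.LatticeModels.box 3 (k * n)) : Set (Literature.Probability.LatticeModels.Site 3)) x y} ≤ 1 - η) → Summit.CriticalPhenomena.PercolationContinuityZ3.Theses.PercLowPointHalfSpace.QuantitativeBGN :=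
  fun ⟨_, hk, _, hη, _, h⟩ => quantitativeBGN_iff.2
    (HalfSpaceBlockingPow.quantitativeBGNAt_of_bulkCrossingBoundRatio _ hk hη h)

end Summit.CriticalPhenomena.PercolationContinuityZ3.Theorems

end
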